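import Summits.KontsevichZagierPeriods.KontsevichZagierPeriods.Theorems.LinRedNormalFormArrangementNormalFormStubRebaseSimplePosOnePosQuadPieces

/-!
# Stub `stub_rebaseSimplePosOnePos` (crux `ArrangementNormalForm`, line `janus-bands`) —
part `QuadCuts`: the eight sector pieces of a normalised flat cell (`B = 2`)

`B = 2` corner calculus, towards the assembly. In the setting of part `QuadPieces` (flat point
at the origin, pole `y = 0`, linear walls and bounds, rows linear or far, unique flat point) with
the far silent factors parallel to the axes, the whole cell is good (`RebasePos.good_frame2`):
choose `ε > 0` below `c / (|r₀| + |r₁|)` for every far row (`RebasePos.exists_eps_rows`), cut by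
`x₁ = 0` and `x₂ = 0` (rule 1a, `RebasePos.cutCell`) and each quadrant `(σ₁, σ₂)` by its
diagonal (`RebasePos.good_quadrant`); the steep part is the standard piece after the reflection
`diag (σ₁, σ₂)`, the flat part after the signed transposition `(0 σ₁; σ₂ 0)`
(`RebasePos.good_piece_signedPerm`). Registered as `rebaseSimplePos_frame2`.

References: M. Kontsevich, D. Zagier, *Periods* (2001), §1.2, rules (1a), (2).
-/

noncomputable section

open Set MeasureTheory MvPolynomial
open Literature.NumberTheory.Transcendental Literature.ModelTheory.ExponentialFields

namespace Summit.KontsevichZagierPeriods.ArrangementNormalForm.JanusBands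

namespace RebasePos

open SeparatePos

section Cuts

variable {m k k' n : ℕ} (Lc : Fin m → (Fin 2 → ℚ) × ℚ) (Ec : Fin m → ℕ) (ℓ₁ : (Fin 2 → ℚ) × ℚ)

/-- Negation commutes with lifting an `x'`-form. -/
theorem liftX_neg (g : (Fin 2 → ℚ) × ℚ) : -liftX g = liftX (-g) := by
  refine Prod.ext (funext fun i => ?_) rfl
  show -((Fin.snoc g.1 0 : Fin (2 + 1) → ℚ) i) = (Fin.snoc (-g.1) 0 : Fin (2 + 1) → ℚ) i
  refine Fin.lastCases ?_ (fun j => ?_) i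
  · simp only [Fin.snoc_last, neg_zero]
  · simp only [Fin.snoc_castSucc, Pi.neg_apply]

/-- A common `ε > 0` below `c / (|r₀| + |r₁|)` for finitely many far rows. -/
theorem exists_eps_rows (Rfar : Fin k' → (Fin (2 + 1) → ℚ) × ℚ) (hpos : ∀ j, 0 < (Rfar j).2) :
    ∃ ε : ℚ, 0 < ε ∧ ∀ j, (|(Rfar j).1 0| + |(Rfar j).1 1|) * ε < (Rfar j).2 := by
  induction k' with
  | zero => exact ⟨1, one_pos, fun j => j.elim0⟩
  | succ k ih =>
    obtain ⟨ε, hε, h⟩ := ih (fun j => Rfar (Fin.castSucc j)) (fun j => hpos _)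
    set S : ℚ := |(Rfar (Fin.last k)).1 0| + |(Rfar (Fin.last k)).1 1| with hS
    have hS0 : 0 ≤ S := by positivity
    set ε' : ℚ := (Rfar (Fin.last k)).2 / (2 * (S + 1)) with hε'
    have hε'pos : 0 < ε' := by rw [hε']; exact div_pos (hpos _) (by positivity)
    have hlast : S * ε' < (Rfar (Fin.last k)).2 := by
      rw [hε', mul_div_assoc']
      rw [div_lt_iff₀ (by positivity)]
      nlinarith [hpos (Fin.last k)]
    refine ⟨min ε ε', lt_min hε hε'pos, fun j => ?_⟩
    refine Fin.lastCases ?_ (fun i => ?_) j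
    · exact lt_of_le_of_lt (mul_le_mul_of_nonneg_left (min_le_right _ _) hS0) hlast
    · exact lt_of_le_of_lt (mul_le_mul_of_nonneg_left (min_le_left _ _) (by positivity)) (h i)

/-- **A quadrant of a normalised flat cell is good** (`B = 2`): the quadrant `σ₁ x₁ > 0`,
`σ₂ x₂ > 0` (`σᵢ = ±1`) is cut by its diagonal; the steep part is the standard piece after the
reflection `diag (σ₁, σ₂)`, the flat part after `(0 σ₁; σ₂ 0)`. -/
theorem good_quadrant (σ₁ σ₂ : ℚ) (h1 : σ₁ * σ₁ = 1) (h2 : σ₂ * σ₂ = 1) (ha1 : |σ₁| = 1) (ha2 : |σ₂| = 1)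
    {nQ k₀ : ℕ} (s : KZ.IntegralRep (2 + 1 + 1)) (R : Fin nQ → (Fin (2 + 1) → ℚ) × ℚ) (M₀ : Fin k₀ → (Fin 2 → ℚ) × ℚ)
    (Rlin : Fin k → (Fin (2 + 1) → ℚ) × ℚ) (Rfar : Fin k' → (Fin (2 + 1) → ℚ) × ℚ) (a b : (Fin 2 → ℚ) × ℚ)
    (P : MvPolynomial (Fin 2) ℚ) (U V : (Fin (2 + 1) → ℚ) × ℚ) (ε : ℚ) (hε : 0 < ε)
    (hbd : Bornology.IsBounded s.domain)
    (hdom : s.domain = gDom 2 1 nQ R (fun _ => Sum.inr U) (fun _ => Sum.inr V))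
    (hint : EqOn s.integrand (glit 2 1 P Lc Ec ℓ₁ 0 0 1 (fun _ => some 0)) s.domain)
    (hsec : ∀ z : Fin (2 + 1 + 1) → ℝ, (∀ j, 0 < affF 2 1 (R j) z) ↔ ((∀ j, 0 < affB 2 1 (M₀ j) z) ∧
      affB 2 1 a z < z (Fin.castAdd 1 (Fin.last 2)) ∧ z (Fin.castAdd 1 (Fin.last 2)) < affB 2 1 b z))
    (hR : ∀ z : Fin (2 + 1 + 1) → ℝ, (∀ j, 0 < affF 2 1 (R j) z) ↔
      ((∀ j, 0 < affF 2 1 (Rlin j) z) ∧ (∀ j, 0 < affF 2 1 (Rfar j) z) ∧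
        affB 2 1 a z < z 2 ∧ z 2 < affB 2 1 b z ∧ 0 < (σ₁ : ℝ) * z 0 ∧ 0 < (σ₂ : ℝ) * z 1))
    (hlin : ∀ j, (Rlin j).2 = 0 ∧ (Rlin j).1 2 = 0)
    (hfarR : ∀ j, (Rfar j).1 2 = 0 ∧ (|(Rfar j).1 0| + |(Rfar j).1 1|) * ε < (Rfar j).2)
    (hab : a.2 = 0 ∧ b.2 = 0)
    (hL : ∀ j, (Lc j).2 ≠ 0 → (Lc j).1 1 = 0 ∨ (Lc j).1 0 = 0)
    (hUV : U.1 2 ≠ 0 ∧ U.1 2 = V.1 2 ∧ U.2 = 0 ∧ V.2 = 0)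
    (hcell : ∀ z : Fin (2 + 1 + 1) → ℝ, (∀ j, 0 < affF 2 1 (R j) z) → 0 < affF 2 1 U z ∧ affF 2 1 U z < affF 2 1 V z)
    (huniq : ∀ z : Fin (2 + 1 + 1) → ℝ, affB 2 1 a z = affB 2 1 b z → affF 2 1 U z = affF 2 1 V z → z 0 = 0 ∧ z 1 = 0) :
    ∃ c ∈ AddSubgroup.closure (GGset 2 2 1), KZ.of s - c ∈ KZ.relations := by
  -- the diagonal cut
  set g : (Fin 2 → ℚ) × ℚ := (![-σ₁, σ₂], 0) with hg
  have hgz : ∀ z : Fin (2 + 1 + 1) → ℝ, affB 2 1 g z = (σ₂ : ℝ) * z 1 - (σ₁ : ℝ) * z 0 := fun z => by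
    rw [hg, affB_three]; simp; ring
  have hg0 : g ≠ 0 := fun h => by
    have := congrArg (fun q : (Fin 2 → ℚ) × ℚ => q.1 1) h
    simp [hg] at this
    simp [this] at ha2
  obtain ⟨s₁, s₂, hsub₁, hsub₂, hi₁, hi₂, hd₁, hd₂, -, -, hrel⟩ := cutCell s R M₀ a b U V hdom hsec g hg0
  have hd1 : ∀ z : Fin (2 + 1 + 1) → ℝ, affB 2 1 (![σ₁, 0], 0) z = (σ₁ : ℝ) * z 0 := fun z => by rw [affB_three]; simp
  have hd2 : ∀ z : Fin (2 + 1 + 1) → ℝ, affB 2 1 (![0, σ₂], 0) z = (σ₂ : ℝ) * z 1 := fun z => by rw [affB_three]; simp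
  refine good_of_split hrel ?_ ?_
  · -- steep part: reflection `diag (σ₁, σ₂)`
    refine good_piece_signedPerm Lc Ec ℓ₁ !![σ₁, 0; 0, σ₂] !![σ₁, 0; 0, σ₂]
      (by ext i j; fin_cases i <;> fin_cases j <;> simp [Matrix.mul_apply, Fin.sum_univ_two, h1, h2])
      (by ext i j; fin_cases i <;> fin_cases j <;> simp [Matrix.mul_apply, Fin.sum_univ_two, h1, h2])
      (Or.inr ⟨by simp, by simp⟩) ⟨by simp [ha1], by simp [ha2]⟩ s₁ _ Rlin Rfar a b P U V ε hε (hbd.subset hsub₁) hd₁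
      (by rw [hi₁]; exact hint.mono hsub₁) (fun z => ?_) hlin hfarR hab.1 hab.2 hL hUV.1 hUV.2.1 hUV.2.2.1 hUV.2.2.2
      (fun z hz => hcell z (rows_snoc hz).1) huniq
    rw [rowsF_snoc_iff, hR, affF_liftX, hgz]
    simp only [Matrix.of_apply, Matrix.cons_val', Matrix.cons_val_zero, Matrix.cons_val_one, Matrix.empty_val',
      Matrix.cons_val_fin_one, hd1, hd2]
    constructor
    · rintro ⟨⟨hl, hf, h3, h4, h5, h6⟩, h7⟩; exact ⟨hl, hf, h3, h4, h5, by linarith⟩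
    · rintro ⟨hl, hf, h3, h4, h5, h6⟩; exact ⟨⟨hl, hf, h3, h4, h5, by linarith⟩, by linarith⟩
  · -- flat part: signed transposition `(0 σ₁; σ₂ 0)`
    refine good_piece_signedPerm Lc Ec ℓ₁ !![0, σ₁; σ₂, 0] !![0, σ₂; σ₁, 0]
      (by ext i j; fin_cases i <;> fin_cases j <;> simp [Matrix.mul_apply, Fin.sum_univ_two, h1, h2])
      (by ext i j; fin_cases i <;> fin_cases j <;> simp [Matrix.mul_apply, Fin.sum_univ_two, h1, h2])
      (Or.inl ⟨by simp, by simp⟩) ⟨by simp [ha1], by simp [ha2]⟩ s₂ _ Rlin Rfar a b P U V ε hε (hbd.subset hsub₂) hd₂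
      (by rw [hi₂]; exact hint.mono hsub₂) (fun z => ?_) hlin hfarR hab.1 hab.2 hL hUV.1 hUV.2.1 hUV.2.2.1 hUV.2.2.2
      (fun z hz => hcell z (rows_snoc hz).1) huniq
    rw [rowsF_snoc_iff, hR, affF_neg', affF_liftX, hgz]
    simp only [Matrix.of_apply, Matrix.cons_val', Matrix.cons_val_zero, Matrix.cons_val_one, Matrix.empty_val',
      Matrix.cons_val_fin_one, hd1, hd2]
    constructor
    · rintro ⟨⟨hl, hf, h3, h4, h5, h6⟩, h7⟩; exact ⟨hl, hf, h3, h4, h6, by linarith⟩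
    · rintro ⟨hl, hf, h3, h4, h5, h6⟩; exact ⟨⟨hl, hf, h3, h4, by linarith, h5⟩, by linarith⟩

/-- **A normalised flat cell with axis-parallel far factors is good** (`B = 2`). See the module
docstring: `ε` from `exists_eps_rows`, cuts by `x₁ = 0` and `x₂ = 0`, four quadrants. -/
theorem good_frame2 (s : KZ.IntegralRep (2 + 1 + 1)) (R : Fin n → (Fin (2 + 1) → ℚ) × ℚ)
    (Rlin : Fin k → (Fin (2 + 1) → ℚ) × ℚ) (Rfar : Fin k' → (Fin (2 + 1) → ℚ) × ℚ) (a b : (Fin 2 → ℚ) × ℚ)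
    (P : MvPolynomial (Fin 2) ℚ) (U V : (Fin (2 + 1) → ℚ) × ℚ) (hbd : Bornology.IsBounded s.domain)
    (hdom : s.domain = gDom 2 1 n R (fun _ => Sum.inr U) (fun _ => Sum.inr V))
    (hint : EqOn s.integrand (glit 2 1 P Lc Ec ℓ₁ 0 0 1 (fun _ => some 0)) s.domain)
    (hR : ∀ z : Fin (2 + 1 + 1) → ℝ, (∀ j, 0 < affF 2 1 (R j) z) ↔
      ((∀ j, 0 < affF 2 1 (Rlin j) z) ∧ (∀ j, 0 < affF 2 1 (Rfar j) z) ∧ affB 2 1 a z < z 2 ∧ z 2 < affB 2 1 b z))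
    (hlin : ∀ j, (Rlin j).2 = 0 ∧ (Rlin j).1 2 = 0)
    (hfarR : ∀ j, (Rfar j).1 2 = 0 ∧ 0 < (Rfar j).2)
    (hab : a.2 = 0 ∧ b.2 = 0)
    (hL : ∀ j, (Lc j).2 ≠ 0 → (Lc j).1 1 = 0 ∨ (Lc j).1 0 = 0)
    (hUV : U.1 2 ≠ 0 ∧ U.1 2 = V.1 2 ∧ U.2 = 0 ∧ V.2 = 0)
    (hcell : ∀ z : Fin (2 + 1 + 1) → ℝ, (∀ j, 0 < affF 2 1 (R j) z) → 0 < affF 2 1 U z ∧ affF 2 1 U z < affF 2 1 V z)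
    (huniq : ∀ z : Fin (2 + 1 + 1) → ℝ, affB 2 1 a z = affB 2 1 b z → affF 2 1 U z = affF 2 1 V z → z 0 = 0 ∧ z 1 = 0) :
    ∃ c ∈ AddSubgroup.closure (GGset 2 2 1), KZ.of s - c ∈ KZ.relations := by
  obtain ⟨ε, hε, hεR⟩ := exists_eps_rows Rfar fun j => (hfarR j).2
  have hfarR' : ∀ j, (Rfar j).1 2 = 0 ∧ (|(Rfar j).1 0| + |(Rfar j).1 1|) * ε < (Rfar j).2 :=
    fun j => ⟨(hfarR j).1, hεR j⟩
  -- product presentation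
  set M₀ : Fin (k + k') → (Fin 2 → ℚ) × ℚ :=
    Fin.append (fun j => restr 2 (Rlin j)) (fun j => restr 2 (Rfar j)) with hM₀
  have hM₀iff : ∀ z : Fin (2 + 1 + 1) → ℝ, (∀ j, 0 < affB 2 1 (M₀ j) z) ↔
      ((∀ j, 0 < affF 2 1 (Rlin j) z) ∧ (∀ j, 0 < affF 2 1 (Rfar j) z)) := by
    intro z
    rw [hM₀, Fin.forall_fin_add]
    simp only [Fin.append_left, Fin.append_right, ← affF_yfree _ (hlin _).2, ← affF_yfree _ (hfarR _).1]
  have hsec : ∀ z : Fin (2 + 1 + 1) → ℝ, (∀ j, 0 < affF 2 1 (R j) z) ↔ ((∀ j, 0 < affB 2 1 (M₀ j) z) ∧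
      affB 2 1 a z < z (Fin.castAdd 1 (Fin.last 2)) ∧ z (Fin.castAdd 1 (Fin.last 2)) < affB 2 1 b z) := by
    intro z; rw [hR, hM₀iff, jy_eq]; tauto
  -- cut by `x₁ = 0`
  set g₁ : (Fin 2 → ℚ) × ℚ := (![1, 0], 0) with hg₁
  have hg₁z : ∀ z : Fin (2 + 1 + 1) → ℝ, affB 2 1 g₁ z = z 0 := fun z => by rw [hg₁, affB_three]; simp
  have hg₁0 : g₁ ≠ 0 := fun h => by have := congrArg (fun q : (Fin 2 → ℚ) × ℚ => q.1 0) h; simp [hg₁] at this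
  set g₂ : (Fin 2 → ℚ) × ℚ := (![0, 1], 0) with hg₂
  have hg₂z : ∀ z : Fin (2 + 1 + 1) → ℝ, affB 2 1 g₂ z = z 1 := fun z => by rw [hg₂, affB_three]; simp
  have hg₂0 : g₂ ≠ 0 := fun h => by have := congrArg (fun q : (Fin 2 → ℚ) × ℚ => q.1 1) h; simp [hg₂] at this
  -- the generic quadrant step: after the two cuts with signs `σ₁`, `σ₂`
  have quad : ∀ (σ₁ σ₂ : ℚ), (σ₁ = 1 ∨ σ₁ = -1) → (σ₂ = 1 ∨ σ₂ = -1) →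
      ∀ (t : KZ.IntegralRep (2 + 1 + 1)), t.domain ⊆ s.domain → t.integrand = s.integrand →
      t.domain = gDom 2 1 (n + 1 + 1) (Fin.snoc (Fin.snoc R (liftX (σ₁ • g₁))) (liftX (σ₂ • g₂)))
        (fun _ => Sum.inr U) (fun _ => Sum.inr V) →
      (∀ z : Fin (2 + 1 + 1) → ℝ, (∀ j, 0 < affF 2 1 ((Fin.snoc (Fin.snoc R (liftX (σ₁ • g₁))) (liftX (σ₂ • g₂)) :
          Fin (n + 1 + 1) → _) j) z) ↔
        ((∀ j, 0 < affB 2 1 ((Fin.snoc (Fin.snoc M₀ (σ₁ • g₁)) (σ₂ • g₂) : Fin (k + k' + 1 + 1) → _) j) z) ∧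
          affB 2 1 a z < z (Fin.castAdd 1 (Fin.last 2)) ∧ z (Fin.castAdd 1 (Fin.last 2)) < affB 2 1 b z)) →
      ∃ c ∈ AddSubgroup.closure (GGset 2 2 1), KZ.of t - c ∈ KZ.relations := by
    intro σ₁ σ₂ hσ₁ hσ₂ t hsub hi hd hsec'
    have h1 : σ₁ * σ₁ = 1 := by rcases hσ₁ with rfl | rfl <;> norm_num
    have h2 : σ₂ * σ₂ = 1 := by rcases hσ₂ with rfl | rfl <;> norm_num
    have ha1 : |σ₁| = 1 := by rcases hσ₁ with rfl | rfl <;> norm_num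
    have ha2 : |σ₂| = 1 := by rcases hσ₂ with rfl | rfl <;> norm_num
    refine good_quadrant Lc Ec ℓ₁ σ₁ σ₂ h1 h2 ha1 ha2 t _ _ Rlin Rfar a b P U V ε hε (hbd.subset hsub) hd
      (by rw [hi]; exact hint.mono hsub) hsec' (fun z => ?_) hlin hfarR' hab hL hUV
      (fun z hz => hcell z (rows_snoc (rows_snoc hz).1).1) huniq
    rw [rowsF_snoc_iff, rowsF_snoc_iff, hR, affF_liftX, affF_liftX, affB_smul', affB_smul', hg₁z, hg₂z]
    tauto
  -- the four quadrants
  obtain ⟨s₁, s₂, hsub₁, hsub₂, hi₁, hi₂, hd₁, hd₂, hsec₁, hsec₂, hrel⟩ := cutCell s R M₀ a b U V hdom hsec g₁ hg₁0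
  refine good_of_split hrel ?_ ?_
  · obtain ⟨t₁, t₂, hs₁, hs₂, hj₁, hj₂, he₁, he₂, hsc₁, hsc₂, hrel'⟩ := cutCell s₁ _ _ a b U V hd₁ hsec₁ g₂ hg₂0
    refine good_of_split hrel' ?_ ?_
    · refine quad 1 1 (Or.inl rfl) (Or.inl rfl) t₁ (hs₁.trans hsub₁) (hj₁.trans hi₁) ?_ ?_
      · rw [he₁, one_smul, one_smul]
      · intro z; rw [one_smul, one_smul]; exact hsc₁ z
    · refine quad 1 (-1) (Or.inl rfl) (Or.inr rfl) t₂ (hs₂.trans hsub₁) (hj₂.trans hi₁) ?_ ?_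
      · rw [he₂, one_smul, neg_one_smul, liftX_neg]
      · intro z; rw [one_smul, neg_one_smul, ← liftX_neg]; exact hsc₂ z
  · obtain ⟨t₁, t₂, hs₁, hs₂, hj₁, hj₂, he₁, he₂, hsc₁, hsc₂, hrel'⟩ := cutCell s₂ _ _ a b U V hd₂ hsec₂ g₂ hg₂0
    refine good_of_split hrel' ?_ ?_
    · refine quad (-1) 1 (Or.inr rfl) (Or.inl rfl) t₁ (hs₁.trans hsub₂) (hj₁.trans hi₂) ?_ ?_
      · rw [he₁, one_smul, neg_one_smul, liftX_neg]
      · intro z; rw [one_smul, neg_one_smul, ← liftX_neg]; exact hsc₁ z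
    · refine quad (-1) (-1) (Or.inr rfl) (Or.inr rfl) t₂ (hs₂.trans hsub₂) (hj₂.trans hi₂) ?_ ?_
      · rw [he₂, neg_one_smul, neg_one_smul, liftX_neg, liftX_neg]
      · intro z; rw [neg_one_smul, neg_one_smul, ← liftX_neg, ← liftX_neg]; exact hsc₂ z

/-- Replacing the silent factors with exponent `0` by the constant form `1`. -/
def cleanLQ (Lt : Fin m → (Fin 2 → ℚ) × ℚ) (Et : Fin m → ℕ) : Fin m → (Fin 2 → ℚ) × ℚ :=
  fun j => if Et j = 0 then ((![0, 0] : Fin 2 → ℚ), 1) else Lt j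

/-- Cleaning does not change the integrand. -/
theorem glit_cleanLQ (P : MvPolynomial (Fin 2) ℚ) (Lt : Fin m → (Fin 2 → ℚ) × ℚ) (Et : Fin m → ℕ)
    (w : Fin (2 + 1 + 1) → ℝ) :
    glit 2 1 P Lt Et ℓ₁ 0 0 1 (fun _ => some 0) w = glit 2 1 P (cleanLQ Lt Et) Et ℓ₁ 0 0 1 (fun _ => some 0) w := by
  rw [glit_three, glit_three]
  congr 3
  refine Finset.prod_congr rfl fun j _ => ?_
  unfold cleanLQ
  split_ifs with h
  · rw [h, pow_zero, pow_zero]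
  · rfl

/-- **A normalised flat cell whose far factors are `x₁`-forms or one line `G₀ x₁ + x₂ + G_c` is
good** (`B = 2`): clean the exponents, shear `x₂ ↦ x₂ − G₀ x₁` (rule 2, `quadNormalize`) to make
the line `x₂`-parallel, and apply `good_frame2`. This is the shape of the terminal data of the
far-factor separation (parts `QuadFarSep`, `QuadFrame1`). -/
theorem good_frame1_term (Lt : Fin m → (Fin 2 → ℚ) × ℚ) (Et : Fin m → ℕ) (G₀ Gc : ℚ)
    (s : KZ.IntegralRep (2 + 1 + 1)) (R : Fin n → (Fin (2 + 1) → ℚ) × ℚ)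
    (Rlin : Fin k → (Fin (2 + 1) → ℚ) × ℚ) (Rfar : Fin k' → (Fin (2 + 1) → ℚ) × ℚ) (a b : (Fin 2 → ℚ) × ℚ)
    (P : MvPolynomial (Fin 2) ℚ) (U V : (Fin (2 + 1) → ℚ) × ℚ) (hbd : Bornology.IsBounded s.domain)
    (hdom : s.domain = gDom 2 1 n R (fun _ => Sum.inr U) (fun _ => Sum.inr V))
    (hint : EqOn s.integrand (glit 2 1 P Lt Et ℓ₁ 0 0 1 (fun _ => some 0)) s.domain)
    (hR : ∀ z : Fin (2 + 1 + 1) → ℝ, (∀ j, 0 < affF 2 1 (R j) z) ↔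
      ((∀ j, 0 < affF 2 1 (Rlin j) z) ∧ (∀ j, 0 < affF 2 1 (Rfar j) z) ∧ affB 2 1 a z < z 2 ∧ z 2 < affB 2 1 b z))
    (hlin : ∀ j, (Rlin j).2 = 0 ∧ (Rlin j).1 2 = 0)
    (hfarR : ∀ j, (Rfar j).1 2 = 0 ∧ 0 < (Rfar j).2)
    (hab : a.2 = 0 ∧ b.2 = 0)
    (hLt : ∀ j, Et j ≠ 0 → (Lt j).2 ≠ 0 → (Lt j).1 1 = 0 ∨ Lt j = (![G₀, 1], Gc))
    (hUV : U.1 2 ≠ 0 ∧ U.1 2 = V.1 2 ∧ U.2 = 0 ∧ V.2 = 0)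
    (hcell : ∀ z : Fin (2 + 1 + 1) → ℝ, (∀ j, 0 < affF 2 1 (R j) z) → 0 < affF 2 1 U z ∧ affF 2 1 U z < affF 2 1 V z)
    (huniq : ∀ z : Fin (2 + 1 + 1) → ℝ, affB 2 1 a z = affB 2 1 b z → affF 2 1 U z = affF 2 1 V z → z 0 = 0 ∧ z 1 = 0) :
    ∃ c ∈ AddSubgroup.closure (GGset 2 2 1), KZ.of s - c ∈ KZ.relations := by
  have hint' : EqOn s.integrand (glit 2 1 P (cleanLQ Lt Et) Et ℓ₁ 0 0 1 (fun _ => some 0)) s.domain :=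
    fun w hw => by rw [hint hw, glit_cleanLQ]
  set A : Matrix (Fin 2) (Fin 2) ℚ := !![1, 0; -G₀, 1] with hA
  set Ai : Matrix (Fin 2) (Fin 2) ℚ := !![1, 0; G₀, 1] with hAi
  have hAAi : A * Ai = 1 := by
    ext i j; fin_cases i <;> fin_cases j <;> simp [hA, hAi, Matrix.mul_apply, Fin.sum_univ_two]
  have hAiA : Ai * A = 1 := by
    ext i j; fin_cases i <;> fin_cases j <;> simp [hA, hAi, Matrix.mul_apply, Fin.sum_univ_two]
  obtain ⟨s', hbd', hdom', hint'', hmem', hrel'⟩ :=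
    quadNormalize 0 A Ai 1 0 hAAi hAiA (by norm_num) s R (cleanLQ Lt Et) Et P ℓ₁ U V hbd hdom hint'
  suffices h' : ∃ c ∈ AddSubgroup.closure (GGset 2 2 1), KZ.of s' - c ∈ KZ.relations by
    obtain ⟨c, hc, hc'⟩ := h'
    exact ⟨c, hc, by have := add_mem hrel' hc'; rwa [sub_add_sub_cancel] at this⟩
  have hnm : ∀ w : Fin (2 + 1 + 1) → ℝ, normMapQ 0 A 1 0 w 2 = w 2 := fun w => by simp [normMapQ_two]
  refine good_frame2 (fun j => normLQ 0 A (cleanLQ Lt Et j)) Et ℓ₁ s' _ (fun j => normFQ 0 A 1 0 (Rlin j))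
    (fun j => normFQ 0 A 1 0 (Rfar j)) (normLQ 0 A a) (normLQ 0 A b) (normPQ 0 A 1 P) (normFQ 0 A 1 0 U)
    (normFQ 0 A 1 0 V) hbd' hdom' hint'' (fun w => ?_) (fun j => ?_) (fun j => ?_) ?_ (fun j h2 => ?_) ?_
    (fun w hw => ?_) (fun w h1 h2 => ?_)
  · simp only [affF_normFQ, affB_normLQ 0 A 1 0, hR, hnm]
  · exact ⟨by simp [normFQ, (hlin j).1, (hlin j).2], by simp [normFQ, (hlin j).2]⟩
  · exact ⟨by simp [normFQ, (hfarR j).1], by simpa [normFQ, (hfarR j).1] using (hfarR j).2⟩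
  · exact ⟨by simp [normLQ, hab.1], by simp [normLQ, hab.2]⟩
  · -- the far factors become parallel to the axes
    have h2' : (cleanLQ Lt Et j).2 ≠ 0 := by simpa [normLQ] using h2
    by_cases hE : Et j = 0
    · left; simp [normLQ, cleanLQ, hE]
    · have hc : cleanLQ Lt Et j = Lt j := by simp [cleanLQ, hE]
      rw [hc] at h2' ⊢
      rcases hLt j hE h2' with h1 | hG
      · left; simp [normLQ, h1, hA]
      · right; simp [normLQ, hG, hA]
  · refine ⟨by simpa [normFQ] using hUV.1, by simp [normFQ, hUV.2.1], by simp [normFQ, hUV.2.2.1],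
      by simp [normFQ, hUV.2.2.2]⟩
  · have hz : ∀ j, 0 < affF 2 1 (R j) (normMapQ 0 A 1 0 w) := fun j => by rw [← affF_normFQ 0 A 1 0]; exact hw j
    have h := hcell _ hz
    rwa [← affF_normFQ 0 A 1 0, ← affF_normFQ 0 A 1 0] at h
  · rw [affB_normLQ 0 A 1 0, affB_normLQ 0 A 1 0] at h1
    rw [affF_normFQ, affF_normFQ] at h2
    obtain ⟨h0, h1'⟩ := huniq _ h1 h2
    have key := normInvQ_normMapQ 0 A Ai 1 0 hAiA (by norm_num) w
    have e0 := congrFun key 0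
    have e1 := congrFun key 1
    simp only [normInvQ, h0, h1', Matrix.cons_val_zero, Matrix.cons_val_one] at e0 e1
    simp at e0 e1
    exact ⟨e0.symm, e1.symm⟩

end Cuts

end RebasePos

/-- **Registered part of `stub_rebaseSimplePosOnePos` (line `janus-bands`, `B = 2` corner
calculus): a normalised flat cell is good** (`RebasePos.good_frame1_term`). A parallel
transverse band over a product cell of the base `(x₁, x₂, y)` with the flat point at the origin
and unique (`huniq`), pole `y = 0`, linear walls `a < y < b` and bounds `U < t < V`, rows linear
or far, and far silent factors `x₁`-forms or one line `G₀ x₁ + x₂ + G_c` lies in the subgroup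
generated by `GG 2 2 1` modulo `KZ.relations`: shear, `ε`, cuts into eight sector pieces, signed
permutations, blow-up of the steep piece (parts `QuadPieces`, `QuadSector`, `QuadMove`,
`QuadClose`). -/
theorem rebaseSimplePos_frame1Term (m k k' n : ℕ) (ℓ₁ : (Fin 2 → ℚ) × ℚ) (Lt : Fin m → (Fin 2 → ℚ) × ℚ) (Et : Fin m → ℕ) (G₀ Gc : ℚ) (s : KZ.IntegralRep (2 + 1 + 1)) (R : Fin n → (Fin (2 + 1) → ℚ) × ℚ) (Rlin : Fin k → (Fin (2 + 1) → ℚ) × ℚ) (Rfar : Fin k' → (Fin (2 + 1) → ℚ) × ℚ) (a b : (Fin 2 → ℚ) × ℚ) (P : MvPolynomial (Fin 2) ℚ) (U V : (Fin (2 + 1) → ℚ) × ℚ) (hbd : Bornology.IsBounded s.domain) (hdom : s.domain = SeparatePos.gDom 2 1 n R (fun _ => Sum.inr U) (fun _ => Sum.inr V)) (hint : Set.EqOn s.integrand (RebasePos.glit 2 1 P Lt Et ℓ₁ 0 0 1 (fun _ => some 0)) s.domain) (hR : ∀ z : Fin (2 + 1 + 1) → ℝ, (∀ j, 0 < SeparatePos.affF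 2 1 (R j) z) ↔ ((∀ j, 0 < SeparatePos.affF 2 1 (Rlin j) z) ∧ (∀ j, 0 < SeparatePos.affF 2 1 (Rfar j) z) ∧ SeparatePos.affB 2 1 a z < z 2 ∧ z 2 < SeparatePos.affB 2 1 b z)) (hlin : ∀ j, (Rlin j).2 = 0 ∧ (Rlin j).1 2 = 0) (hfarR : ∀ j, (Rfar j).1 2 = 0 ∧ 0 < (Rfar j).2) (hab : a.2 = 0 ∧ b.2 = 0) (hLt : ∀ j, Et j ≠ 0 → (Lt j).2 ≠ 0 → (Lt j).1 1 = 0 ∨ Lt j = (![G₀, 1], Gc)) (hUV : U.1 2 ≠ 0 ∧ U.1 2 = V.1 2 ∧ U.2 = 0 ∧ V.2 = 0) (hcell : ∀ z : Fin (2 + 1 + 1) → ℝ, (∀ j, 0 < SeparatePos.affF 2 1 (R j) z) → 0 < SeparatePos.affF 2 1 U z ∧ SeparatePos.affF 2 1 U z < SeparatePos.affF 2 1 V z) (huniq : ∀ z : Fin (2 + 1 + 1) → ℝ, SeparatePos.affB 2 1 a z = SeparatePos.affB 2 1 b z → SeparatePos.affF 2 1 U z = SeparatePos.affF 2 1 V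 z → z 0 = 0 ∧ z 1 = 0) : ∃ c ∈ AddSubgroup.closure (SeparatePos.GGset 2 2 1), KZ.of s - c ∈ KZ.relations :=
  RebasePos.good_frame1_term ℓ₁ Lt Et G₀ Gc s R Rlin Rfar a b P U V hbd hdom hint hR hlin hfarR hab hLt hUV hcell huniq

end Summit.KontsevichZagierPeriods.ArrangementNormalForm.JanusBands
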